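import Summits.BirchSwinnertonDyer.BirchSwinnertonDyer.Theorems.ManinLocalTwoThreeKummerCubeSigmaMonodromyPrelims
import Summits.BirchSwinnertonDyer.Rank1Residual.ManinAdditive.KummerCubeMonodromy
import Literature.NumberTheory.EllipticCurves.WeierstrassSigmaProofs
import Literature.NumberTheory.EllipticCurves.WeierstrassZetaLegendre
import Literature.NumberTheory.EllipticCurves.WeierstrassTorsion
import Literature.NumberTheory.EllipticCurves.WeierstrassPMultiplication
import Literature.NumberTheory.EllipticCurves.RealLatticePeriodHalfPeriodsProofs
import Literature.NumberTheory.EllipticCurves.ComplexTorus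
import Literature.NumberTheory.EllipticCurves.EichlerIntegralWeierstrassProofs
import Literature.NumberTheory.EllipticCurves.ModularSymbolsLattice
import HarnessLib

/-!
# Leaf S4 `SigmaCubeRootMonodromy` of the `σ`-monodromy line CLOSED (the monodromy step; T-an-40 (d), part 2 of 2)
# (route `ManinLocalTwoThree`, crux C3 `ManinPrimeToThreeAtNine` stmt-BirchSwinnertonDyer-22968; cell bsd-f2-manin: proof by planner
# `-an` g37 — HOME/an/g37/KummerSigmaMonodromyLeaves-an-g37.lean sha16 605035015c928e28, l.43–100 and l.609–976, landed verbatim up to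
# namespace by p2 gen 16 per the -ty g20 12:58Z routing; MEMO-an §80.9)

The statement file `Rank1Residual/ManinAdditive/KummerCubeMonodromy.lean` (p718910) reduces the C3 v19 leaf P79
`KummerCubeSeriesNotCubeAtThreeN` (and G0) to seven typed leaves (assembly `Theorems/ManinLocalTwoThreeKummerCubeMonodromy.lean`,
p719392).  S2, S3, S3′, S3b, S6 are proved in `…KummerCubeQExpansionPrinciple.lean`, `…KummerCubeSigmaTangentLine.lean`,
`…KummerCubeSigmaLeaves.lean`.  This file PROVES S4 by name: `sigmaCubeRootMonodromy : SigmaCubeRootMonodromy`.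

Proof architecture.  Write `v(z) = c·2πi∫_{i∞}^z f`, `W = W_{a,e}` (`sigmaCubeRoot`).
1. (`…KummerCubeSigmaMonodromyPrelims.lean`) `sigmaCubeRoot_add_of_mem_lattice`: `W(w + μ) = ρ_μ·W(w)` for every `μ ∈ Λ` with a
   constant `ρ_μ ≠ 0` (the set of such `μ` is an additive subgroup containing `ω₁, ω₂`).
2. (Prelims) `exists_entire_weierstrassP_sigma`: the ENTIRE functions `P₂ = σ'² − σσ'' (= ℘σ²)` and `P₃ = σP₂' − 2σ'P₂ (= ℘'σ³)`.
3. Clearing denominators, `A = F·c·P₃(v)` and `B = −2·G·P₂(v)·e^{ev/3}·σ(v − a)` are holomorphic on `{im > 0}` and the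
   hypothesis gives `A³ = C·B³` near the base point (generic points: `eventually_eichlerIntegral_affine_notMem`), hence on
   all of `{im > 0}` (identity theorem).
4. `A³ − C·B³ = ∏ (A − ωⁱκB)` (`κ³ = C`, `ω = e^{2πi/3}`) and holomorphic functions on the connected half-plane form an
   integral domain, so `A = κ₀B` globally for a cube root `κ₀` of `C` — a GLOBAL cube root, no monodromy of `∛` left.
5. Evaluating `A = κ₀B` at a generic `τ₁` and at `γτ₁` (`v(γτ₁) = v(τ₁) + c·{∞,γ∞}`, automorphy of `F, G` with the same
   factor, `Λ`-periodicity of `℘, ℘'`) gives `W(v + μ) = W(v) ≠ 0`, so `ρ_μ = 1`.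
After this file the `σ`-monodromy reduction of P79/G0 has exactly ONE open leaf: S1 `KummerCubeAnalyticDictionary`.
HONEST FRAMING: a leaf of a CONDITIONAL reduction; P79, G0, E-an-57 and C3 remain OPEN; nothing about BSD or Manin's
conjecture is proved.  [cite: WhittakerWatson1927, §20.421 (σ quasi-periodicity), §20.411 (Legendre)]
[cite: Manin1972, Prop. 1.4 (u(γτ) − u(τ) = {∞, γ∞}; shape)]
-/

set_option autoImplicit false
-- lint-debt: the directory name repeats the summit name (sibling precedent `ManinLocalTwoThreeKummerCubeSigmaLeaves.lean`)
set_option linter.dupNamespace false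

noncomputable section

open Complex Filter Topology
open scoped PeriodPair UpperHalfPlane
open WeierstrassCurve Literature.NumberTheory.EllipticCurves Literature.NumberTheory.EllipticCurves.ModularForms
open Summit.BirchSwinnertonDyer.Rank1Residual.ManinAdditive.CuspidalKummer
open Summit.BirchSwinnertonDyer.Rank1Residual.ManinAdditive.CuspidalKummerThree
open Summit.BirchSwinnertonDyer.Rank1Residual.ManinAdditive.KummerCubeMonodromy

namespace Summit.BirchSwinnertonDyer.BirchSwinnertonDyer.Theorems.ManinLocalTwoThree.KummerCubeSigmaLeaves

/-! ## S4 — `SigmaCubeRootMonodromy` (the monodromy step of the `σ`-line)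

Proof architecture (MEMO-an §80.9).  Write `v(z) = c·2πi∫_{i∞}^z f`, `W = W_{a,e}` (`sigmaCubeRoot`).
1. `sigmaCubeRoot_add_of_mem_lattice`: `W(w + μ) = ρ_μ·W(w)` for every `μ ∈ Λ` with a constant `ρ_μ ≠ 0`
   (the set of such `μ` is an additive subgroup containing `ω₁, ω₂`).
2. `exists_entire_weierstrassP_sigma`: the ENTIRE functions `P₂ = σ'² − σσ'' (= ℘σ²)` and `P₃ = σP₂' − 2σ'P₂ (= ℘'σ³)`.
3. Clearing denominators, `A = F·c·P₃(v)` and `B = −2·G·P₂(v)·e^{ev/3}·σ(v − a)` are holomorphic on `{im > 0}` and the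
   hypothesis gives `A³ = C·B³` near `i∞` (generic points: `eventually_eichlerIntegral_affine_notMem`), hence on all of
   `{im > 0}` (identity theorem).
4. `A³ − C·B³ = ∏ (A − ωⁱκB)` (`κ³ = C`, `ω = e^{2πi/3}`) and holomorphic functions on the connected half-plane form an
   integral domain, so `A = κ₀B` globally for a cube root `κ₀` of `C` — a GLOBAL cube root, no monodromy of `∛` left.
5. Evaluating `A = κ₀B` at a generic `τ₁` and at `γτ₁` (`v(γτ₁) = v(τ₁) + c·{∞,γ∞}`, automorphy of `F, G` with the same
   factor, `Λ`-periodicity of `℘, ℘'`) gives `W(v + μ) = W(v) ≠ 0`, so `ρ_μ = 1`. -/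

section S4

open UpperHalfPlane CongruenceSubgroup
open scoped MatrixGroups ModularForm

/-- **S4 — `SigmaCubeRootMonodromy` PROVED**: if `F³ = C·(t_s·W(w(τ)))³·G³` near the base point for modular forms
`F, G ∈ M_k(Γ₀(M))`, `G ≠ 0`, `C ≠ 0`, `N ∣ M`, then the `σ`-cube root `W = W_{a,e}` is periodic under `c·{∞, γ∞}_f` for
every `γ ∈ Γ₀(N)` lying in `Γ₀(M)` (global cube root on the half-plane + automorphy; see the module docstring).
[cite: Manin1972, Prop. 1.4 (shape)] -/
theorem sigmaCubeRootMonodromy : SigmaCubeRootMonodromy := by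
  intro W _ _ N _ D a e M _ k F G C B _hNM hG hC hhyp γ hγM w₀
  by_cases hc0 : (D.c : ℂ) = 0
  · rw [hc0, zero_mul, add_zero]
  -- notation
  obtain ⟨c, hc⟩ : ∃ c : ℂ, c = (D.c : ℂ) := ⟨_, rfl⟩
  obtain ⟨f, hf⟩ : ∃ f : CuspForm (Gamma0 N) 2, f = D.f := ⟨_, rfl⟩
  obtain ⟨L, hL⟩ : ∃ L : PeriodPair, L = D.L := ⟨_, rfl⟩
  rw [← hc] at hc0
  rw [← hc, ← hf, ← hL] at hhyp ⊢
  have hμ : c * cuspSymbol f γ ∈ L.lattice := by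
    rw [hc, hf, hL]; exact D.smul_periodLattice_le _ (cuspSymbol_mem_periodLattice D.f γ)
  obtain ⟨μ, hμdef⟩ : ∃ μ : ℂ, μ = c * cuspSymbol f γ := ⟨_, rfl⟩
  rw [← hμdef] at hμ ⊢
  obtain ⟨ρ, hρ0, hρ⟩ := sigmaCubeRoot_add_of_mem_lattice L a e hμ
  rw [hρ]
  suffices hρ1 : ρ = 1 by rw [hρ1, one_mul]
  have hf0 : f ≠ 0 := by rw [hf]; exact D.isNewformOf.1.ne_zero
  -- entire `P₂ = ℘σ²`, `P₃ = ℘'σ³`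
  obtain ⟨P₂, P₃, hP₂d, hP₃d, hP₂, hP₃⟩ := exists_entire_weierstrassP_sigma L
  have hσd : Differentiable ℂ L.weierstrassSigma := L.differentiable_weierstrassSigma_holds
  have hσne : ∀ w, w ∉ L.lattice → L.weierstrassSigma w ≠ 0 := fun w hw h ↦
    hw ((L.weierstrassSigma_eq_zero_iff_holds w).mp h)
  -- the holomorphic functions of the complex variable on `U = {im > 0}`
  obtain ⟨U, hUdef⟩ : ∃ U : Set ℂ, U = {z : ℂ | 0 < z.im} := ⟨_, rfl⟩
  have hUo : IsOpen U := by rw [hUdef]; exact isOpen_upperHalfPlaneSet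
  have hconn : IsPreconnected U := by rw [hUdef]; exact convex_setOf_im_pos.isPreconnected
  obtain ⟨v, hvdef⟩ : ∃ v : ℂ → ℂ, v = fun z ↦ c * eichlerIntegral f (ofComplex z) := ⟨_, rfl⟩
  obtain ⟨Ac, hAdef⟩ : ∃ Ac : ℂ → ℂ, Ac = fun z ↦ F (ofComplex z) * (c * P₃ (v z)) := ⟨_, rfl⟩
  obtain ⟨Bc, hBdef⟩ : ∃ Bc : ℂ → ℂ, Bc = fun z ↦
      -2 * G (ofComplex z) * (P₂ (v z) * cexp (e * v z / 3) * L.weierstrassSigma (v z - a)) := ⟨_, rfl⟩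
  have hv : DifferentiableOn ℂ v U := by
    rw [hvdef, hUdef]; exact (differentiableOn_eichlerIntegral_comp_ofComplex f).const_mul c
  have hFc : DifferentiableOn ℂ (⇑F ∘ ofComplex) U := by
    rw [hUdef]; exact UpperHalfPlane.mdifferentiable_iff.mp (ModularFormClass.holo F)
  have hGc : DifferentiableOn ℂ (⇑G ∘ ofComplex) U := by
    rw [hUdef]; exact UpperHalfPlane.mdifferentiable_iff.mp (ModularFormClass.holo G)
  have hAc : DifferentiableOn ℂ Ac U := by
    rw [hAdef]
    exact hFc.mul (((hP₃d.comp_differentiableOn hv)).const_mul c)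
  have hBc : DifferentiableOn ℂ Bc U := by
    rw [hBdef]
    exact (hGc.const_mul (-2)).mul ((((hP₂d.comp_differentiableOn hv)).mul
      (((hv.const_mul e).div_const 3).cexp)).mul (hσd.comp_differentiableOn (hv.sub_const a)))
  -- base point `z₀ = (max B 0 + 1)·i`
  obtain ⟨y₀, hy₀⟩ : ∃ y₀ : ℝ, y₀ = max B 0 + 1 := ⟨_, rfl⟩
  have hy₀pos : 0 < y₀ := by rw [hy₀]; have := le_max_right B 0; linarith
  have hy₀B : B < y₀ := by rw [hy₀]; have := le_max_left B 0; linarith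
  obtain ⟨z₀, hz₀def⟩ : ∃ z₀ : ℂ, z₀ = (y₀ : ℂ) * Complex.I := ⟨_, rfl⟩
  have hz₀im : z₀.im = y₀ := by rw [hz₀def]; simp
  have hz₀ : 0 < z₀.im := by rw [hz₀im]; exact hy₀pos
  have hz₀U : z₀ ∈ U := by rw [hUdef]; exact hz₀
  have hgen : ∀ α : ℂ, α ≠ 0 → ∀ β : ℂ, ∀ᶠ z in 𝓝[≠] z₀, α * eichlerIntegral f (ofComplex z) + β ∉ L.lattice :=
    fun α hα β ↦ eventually_eichlerIntegral_affine_notMem f hf0 L hz₀ hα β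
  have hU' : ∀ᶠ z in 𝓝 z₀, 0 < z.im := isOpen_upperHalfPlaneSet.mem_nhds hz₀
  have hB' : ∀ᶠ z in 𝓝 z₀, B < z.im :=
    (isOpen_lt continuous_const Complex.continuous_im).mem_nhds (by simpa [hz₀im] using hy₀B)
  -- Step 3: the cubed identity `Ac³ = C·Bc³` on all of `U`
  have hcube : Set.EqOn (fun z ↦ Ac z ^ 3 - C * Bc z ^ 3) 0 U := by
    have han : AnalyticOnNhd ℂ (fun z ↦ Ac z ^ 3 - C * Bc z ^ 3) U :=
      ((hAc.pow 3).sub ((hBc.pow 3).const_mul C)).analyticOnNhd hUo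
    apply han.eqOn_zero_of_preconnected_of_frequently_eq_zero hconn hz₀U
    have hev : ∀ᶠ z in 𝓝[≠] z₀, Ac z ^ 3 - C * Bc z ^ 3 = 0 := by
      filter_upwards [hgen c hc0 0, hgen (2 * c) (mul_ne_zero two_ne_zero hc0) 0,
        nhdsWithin_le_nhds hB', nhdsWithin_le_nhds hU'] with z hz1 hz2 hzB hzU
      have hτ : ofComplex z = ⟨z, hzU⟩ := ofComplex_apply_of_im_pos hzU
      obtain ⟨u, hudef⟩ : ∃ u : ℂ, u = c * eichlerIntegral f ⟨z, hzU⟩ := ⟨_, rfl⟩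
      have hvz : v z = u := by rw [hvdef, hudef]; simp [hτ]
      have huΛ : u ∉ L.lattice := by rw [← hvz, hvdef]; simpa using hz1
      have h2u : 2 * u ∉ L.lattice := by rw [← hvz, hvdef]; simpa [mul_assoc] using hz2
      have hσu := hσne u huΛ
      have h℘'u : ℘'[L] u ≠ 0 := L.derivWeierstrassP_ne_zero huΛ h2u
      have hmain := hhyp ⟨z, hzU⟩ hzB (by rw [← hudef]; exact huΛ)
      rw [← hudef] at hmain
      simp only [shortT, shortX, shortY, sigmaCubeRoot] at hmain
      rw [← hL, ← hc, ← hf, ← hudef] at hmain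
      have hA : Ac z = F ⟨z, hzU⟩ * (c * (℘'[L] u * L.weierstrassSigma u ^ 3)) := by
        rw [hAdef]; simp only; rw [hτ, hvz, hP₃ u huΛ]
      have hB : Bc z = -2 * G ⟨z, hzU⟩ * (℘[L] u * L.weierstrassSigma u ^ 2 * cexp (e * u / 3) *
          L.weierstrassSigma (u - a)) := by
        rw [hBdef]; simp only; rw [hτ, hvz, hP₂ u huΛ]
      rw [hA, hB, mul_pow, hmain]
      field_simp
      ring
    exact hev.frequently
  -- Step 4: a global cube root `Ac = κ₀·Bc`
  obtain ⟨κ, hκ⟩ := IsAlgClosed.exists_pow_nat_eq C (by norm_num : 0 < 3)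
  obtain ⟨ω, hωdef⟩ : ∃ ω : ℂ, ω = cexp (((1 : ℤ) : ℂ) * (2 * Real.pi * Complex.I) / 3) := ⟨_, rfl⟩
  have hω3 : ω ^ 3 = 1 := by
    rw [hωdef, ← Complex.exp_nat_mul]
    rw [show ((3 : ℕ) : ℂ) * (((1 : ℤ) : ℂ) * (2 * Real.pi * Complex.I) / 3) = 2 * Real.pi * Complex.I by
      push_cast; ring]
    exact Complex.exp_two_pi_mul_I
  have hω1 : ω ≠ 1 := by
    rw [hωdef]; exact cexp_int_mul_div_three_ne_one 1 _ (Or.inl rfl) (by decide)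
  have hω : 1 + ω + ω ^ 2 = 0 := by
    have h : (ω - 1) * (1 + ω + ω ^ 2) = 0 := by linear_combination hω3
    exact (mul_eq_zero.mp h).resolve_left (sub_ne_zero.mpr hω1)
  have hID : ∀ {g h : ℂ → ℂ}, DifferentiableOn ℂ g U → DifferentiableOn ℂ h U →
      Set.EqOn (g * h) 0 U → Set.EqOn g 0 U ∨ Set.EqOn h 0 U := by
    intro g h hg hh hgh
    by_contra hnot
    push Not at hnot
    obtain ⟨hg0, hh0⟩ := hnot
    obtain ⟨z₁, hz₁U, hgz₁⟩ : ∃ z₁ ∈ U, g z₁ ≠ 0 := by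
      by_contra h'
      push Not at h'
      exact hg0 (fun z hz ↦ by simpa using h' z hz)
    apply hh0
    apply (hh.analyticOnNhd hUo).eqOn_zero_of_preconnected_of_eventuallyEq_zero hconn hz₁U
    have hgc : ContinuousAt g z₁ := hg.continuousOn.continuousAt (hUo.mem_nhds hz₁U)
    filter_upwards [hgc.eventually_ne hgz₁, hUo.mem_nhds hz₁U] with z hz hzU
    have h0 := hgh hzU
    simp only [Pi.mul_apply, Pi.zero_apply, mul_eq_zero] at h0
    simpa using h0.resolve_left hz
  have hlin : ∃ κ₀ : ℂ, κ₀ ^ 3 = C ∧ Set.EqOn (fun z ↦ Ac z - κ₀ * Bc z) 0 U := by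
    have hprod : Set.EqOn ((fun z ↦ Ac z - κ * Bc z) *
        ((fun z ↦ Ac z - ω * κ * Bc z) * (fun z ↦ Ac z - ω ^ 2 * κ * Bc z))) 0 U := by
      intro z hz
      have h0 := hcube hz
      simp only [Pi.mul_apply, Pi.zero_apply] at h0 ⊢
      linear_combination h0 + (κ ^ 2 * Ac z * Bc z ^ 2 - κ * Ac z ^ 2 * Bc z) * hω +
        (κ ^ 2 * Ac z * Bc z ^ 2 - κ ^ 3 * Bc z ^ 3) * hω3 - Bc z ^ 3 * hκ
    have hd1 : DifferentiableOn ℂ (fun z ↦ Ac z - κ * Bc z) U := hAc.sub (hBc.const_mul κ)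
    have hd2 : DifferentiableOn ℂ (fun z ↦ Ac z - ω * κ * Bc z) U := hAc.sub (hBc.const_mul (ω * κ))
    have hd3 : DifferentiableOn ℂ (fun z ↦ Ac z - ω ^ 2 * κ * Bc z) U :=
      hAc.sub (hBc.const_mul (ω ^ 2 * κ))
    rcases hID hd1 (hd2.mul hd3) hprod with h | h
    · exact ⟨κ, hκ, h⟩
    rcases hID hd2 hd3 h with h | h
    · exact ⟨ω * κ, by rw [mul_pow, hω3, one_mul, hκ], h⟩
    · refine ⟨ω ^ 2 * κ, ?_, h⟩
      rw [mul_pow, ← pow_mul, show 2 * 3 = 3 * 2 from rfl, pow_mul, hω3, one_pow, one_mul, hκ]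
  obtain ⟨κ₀, hκ₀3, hlin⟩ := hlin
  have hκ₀ : κ₀ ≠ 0 := by rintro rfl; apply hC; rw [← hκ₀3]; norm_num
  -- Step 5: a generic point `τ₁` and its translate `γτ₁`
  obtain ⟨zP, hzP, hzP0⟩ := L.exists_weierstrassP_eq 0
  obtain ⟨z₁, hz₁v, hz₁a, hz₁p, hz₁m, hz₁G, hz₁U⟩ := ((hgen c hc0 0).and ((hgen c hc0 (-a)).and
    ((hgen c hc0 zP).and ((hgen c hc0 (-zP)).and ((eventually_modularForm_ne_zero G hG hz₀).and
      (nhdsWithin_le_nhds hU')))))).exists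
  have hτ₁ : ofComplex z₁ = ⟨z₁, hz₁U⟩ := ofComplex_apply_of_im_pos hz₁U
  obtain ⟨τ₁, hτ₁def⟩ : ∃ τ₁ : ℍ, τ₁ = ⟨z₁, hz₁U⟩ := ⟨_, rfl⟩
  rw [← hτ₁def] at hτ₁
  have hz₁U' : (τ₁ : ℂ) ∈ U := by rw [hUdef, hτ₁def]; exact hz₁U
  obtain ⟨u, hudef⟩ : ∃ u : ℂ, u = c * eichlerIntegral f τ₁ := ⟨_, rfl⟩
  have hvz₁ : v (τ₁ : ℂ) = u := by rw [hvdef, hudef]; simp [ofComplex_apply]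
  have hz₁eq : (τ₁ : ℂ) = z₁ := by rw [hτ₁def]
  have huΛ : u ∉ L.lattice := by rw [hudef, ← hτ₁]; simpa using hz₁v
  have hua : u - a ∉ L.lattice := by rw [hudef, ← hτ₁, sub_eq_add_neg]; exact hz₁a
  have h℘u : ℘[L] u ≠ 0 := by
    intro h0
    rw [← hzP0] at h0
    rcases (L.weierstrassP_eq_weierstrassP_iff huΛ hzP).mp h0 with h | h
    · exact hz₁p (by rw [hτ₁, ← hudef]; exact h)
    · exact hz₁m (by rw [hτ₁, ← hudef, ← sub_eq_add_neg]; exact h)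
  have hGτ₁ : G τ₁ ≠ 0 := by rw [← hτ₁]; exact hz₁G
  -- the translate
  obtain ⟨τ₂, hτ₂def⟩ : ∃ τ₂ : ℍ, τ₂ = (γ : SL(2, ℤ)) • τ₁ := ⟨_, rfl⟩
  have hz₂U : (τ₂ : ℂ) ∈ U := by rw [hUdef]; exact τ₂.im_pos
  have hE₂ : eichlerIntegral f τ₂ = eichlerIntegral f τ₁ + cuspSymbol f γ := by
    have := eichlerIntegral_smul_sub_holds f γ τ₁
    rw [← hτ₂def] at this
    linear_combination this
  have hvz₂ : v (τ₂ : ℂ) = u + μ := by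
    rw [hvdef, hudef, hμdef]; simp [ofComplex_apply, hE₂, mul_add]
  have huμ : u + μ ∉ L.lattice := fun h ↦ huΛ (by simpa using sub_mem h hμ)
  have huμa : u + μ - a ∉ L.lattice := fun h ↦ hua (by
    have := sub_mem h hμ; rwa [show u + μ - a - μ = u - a by ring] at this)
  have hF₂ := SlashInvariantForm.slash_action_eqn_SL'' F hγM τ₁
  have hG₂ := SlashInvariantForm.slash_action_eqn_SL'' G hγM τ₁
  rw [← hτ₂def] at hF₂ hG₂
  obtain ⟨J, hFJ, hGJ, hJ⟩ : ∃ J : ℂ, F τ₂ = J * F τ₁ ∧ G τ₂ = J * G τ₁ ∧ J ≠ 0 :=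
    ⟨_, hF₂, hG₂, zpow_ne_zero k (denom_ne_zero _ τ₁)⟩
  have h℘μ : ℘[L] (u + μ) = ℘[L] u := L.weierstrassP_add_coe u ⟨μ, hμ⟩
  have h℘'μ : ℘'[L] (u + μ) = ℘'[L] u := L.derivWeierstrassP_add_coe u ⟨μ, hμ⟩
  -- the two linear relations
  have hr₁ := hlin hz₁U'
  have hr₂ := hlin hz₂U
  simp only [Pi.zero_apply] at hr₁ hr₂
  rw [hAdef, hBdef] at hr₁ hr₂
  simp only at hr₁ hr₂
  rw [ofComplex_apply, hvz₁, hP₃ u huΛ, hP₂ u huΛ] at hr₁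
  rw [ofComplex_apply, hvz₂, hP₃ _ huμ, hP₂ _ huμ, h℘μ, h℘'μ, hFJ, hGJ] at hr₂
  have hs₁ := hσne u huΛ
  have hs₂ := hσne _ huμ
  have hK : 2 * κ₀ * G τ₁ * ℘[L] u ≠ 0 :=
    mul_ne_zero (mul_ne_zero (mul_ne_zero two_ne_zero hκ₀) hGτ₁) h℘u
  have e₁ : F τ₁ * c * ℘'[L] u * L.weierstrassSigma u +
      2 * κ₀ * G τ₁ * ℘[L] u * (cexp (e * u / 3) * L.weierstrassSigma (u - a)) = 0 := by
    have h : L.weierstrassSigma u ^ 2 * (F τ₁ * c * ℘'[L] u * L.weierstrassSigma u +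
        2 * κ₀ * G τ₁ * ℘[L] u * (cexp (e * u / 3) * L.weierstrassSigma (u - a))) = 0 := by
      linear_combination hr₁
    exact (mul_eq_zero.mp h).resolve_left (pow_ne_zero _ hs₁)
  have e₂ : F τ₁ * c * ℘'[L] u * L.weierstrassSigma (u + μ) +
      2 * κ₀ * G τ₁ * ℘[L] u * (cexp (e * (u + μ) / 3) * L.weierstrassSigma (u + μ - a)) = 0 := by
    have h : J * L.weierstrassSigma (u + μ) ^ 2 * (F τ₁ * c * ℘'[L] u * L.weierstrassSigma (u + μ) +
        2 * κ₀ * G τ₁ * ℘[L] u * (cexp (e * (u + μ) / 3) * L.weierstrassSigma (u + μ - a))) = 0 := by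
      linear_combination hr₂
    exact (mul_eq_zero.mp h).resolve_left (mul_ne_zero hJ (pow_ne_zero _ hs₂))
  have key : cexp (e * (u + μ) / 3) * L.weierstrassSigma (u + μ - a) * L.weierstrassSigma u =
      cexp (e * u / 3) * L.weierstrassSigma (u - a) * L.weierstrassSigma (u + μ) := by
    have h : 2 * κ₀ * G τ₁ * ℘[L] u *
        (cexp (e * (u + μ) / 3) * L.weierstrassSigma (u + μ - a) * L.weierstrassSigma u -
          cexp (e * u / 3) * L.weierstrassSigma (u - a) * L.weierstrassSigma (u + μ)) = 0 := by
      linear_combination L.weierstrassSigma u * e₂ - L.weierstrassSigma (u + μ) * e₁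
    exact sub_eq_zero.mp ((mul_eq_zero.mp h).resolve_left hK)
  have hWu : sigmaCubeRoot L a e u ≠ 0 := by
    unfold sigmaCubeRoot
    exact div_ne_zero (mul_ne_zero (Complex.exp_ne_zero _) (hσne _ hua)) hs₁
  have hWeq : sigmaCubeRoot L a e (u + μ) = sigmaCubeRoot L a e u := by
    unfold sigmaCubeRoot
    rw [div_eq_div_iff hs₂ hs₁]
    exact key
  rw [hρ u] at hWeq
  exact mul_right_cancel₀ hWu (by rw [hWeq, one_mul])

end S4

end Summit.BirchSwinnertonDyer.BirchSwinnertonDyer.Theorems.ManinLocalTwoThree.KummerCubeSigmaLeaves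

end
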